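import Literature.NumberTheory.LFunctions.VinogradovKorobov

/-!
# The large-height argument of Mossinghoff–Trudgian–Yang (§5), I: the base window and window-minimal zeros

Topic `Literature/NumberTheory/LFunctions`. Part of the decomposition of
`Literature.NumberTheory.LFunctions.zero_free_region_vinogradov_korobov` (rh.S10 = Mossinghoff–Trudgian–Yang, *Res. Number
Theory* 10 (2024) = arXiv:2212.06867, Thm. 1.1; architecture in `VinogradovKorobov.lean`). The aim
of this strand is to PROVE the named fact `Literature.NumberTheory.LFunctions.zero_bound_large_height_mossinghoff_trudgian_yang`
(§5 of the source: every zero `β + it`, `t ≥ T₀ = exp 52238`, has `Z(β, t) ≥ M₁ = 0.048976`,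
`Z(β, t) = (1 − β) B^{2/3} (log t)^{2/3} (log log t)^{1/3}`, `B = 4.45`) from the zero inequality
Lemma 4.7 (`VinogradovKorobovInputs.lean`) and the printed inputs. This first file supplies the
two preliminary steps of §5 that do not involve Lemma 4.7, both from Theorem 1.4
(`zero_free_region_intermediate_mossinghoff_trudgian_yang`). Theorem 1.4 is used only for
`|t| ≥ exp 7000`, and every theorem depending on it is given in two forms: the primed form
(`zero_bound_base_window'`, `one_sub_ge_of_intermediate'`, `mtyZ_mul_rpow_ge'`, `mtyZ_nonneg'`,
`exists_window_minimal_zero_of_le'`, `exists_window_minimal_zero'`) assumes only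
`hI : IntermediateRegionFrom (exp 7000)` — a definition made here: the region of Theorem 1.4
asserted from a given height on; this is the form fed by the proof of Theorem 1.4 from Lemma 6.1
(`VinogradovKorobovIntermediate.lean`, which delivers it from `exp 1001` on) — and the unprimed
form takes Theorem 1.4 itself (through `intermediateRegionFrom_exp_7000`):

* `Literature.NumberTheory.LFunctions.VK.third_inequality`, `Literature.NumberTheory.LFunctions.VK.zero_bound_base_window` — the source's "third
  inequality … verified by a numerical computation": on the base window `t ∈ [T₀ − 1, T₀)` (indeed
  on `exp 52237.99 ≤ t ≤ exp 52238`) Theorem 1.4 already gives `Z(β, t) ≥ M₁`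
  (certificate: `(0.05035/h − 0.0349/h²) · 4.45^{2/3} u^{2/3}(log u)^{1/3} ≥ 0.048976` on
  `[52237.99, 52238]`, relative margin `1.0·10⁻⁵`, via the segment machinery of
  `VinogradovKorobov.lean`);
* `Literature.NumberTheory.LFunctions.VK.exists_window_minimal_zero` (and `…_of_le`, for any threshold `M ≤ M₁`) — **the
  choice of the zero `β + it`.** The source sets
  `M := inf Z` over zeros of height `≥ T₀`, assumes `M < M₁`, and picks a zero with
  `M ≤ Z ≤ M(1 + δ)`, `δ = min(10⁻¹⁰⁰/log T₀, (M₁ − M)/(2M))`; this needs `M > 0`, which the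
  source does not justify (it would follow from an inexplicit Vinogradov–Korobov region). We
  replace it by a self-contained statement with the same output: if some zero of height `≥ T₀`
  has `Z < M₁`, then for every `δ > 0` there is such a zero which is *window-minimal up to the
  factor `1 + δ`* — every zero `β' + it'` with `t − 1 ≤ t' ≤ 40t + 1` has
  `(1 + δ) Z(β', t') ≥ Z(β, t)`. This is exactly what (5.3)–(5.4) of the source use (the rectangle
  `1 − λ < Re s ≤ 1`, `t − 1 ≤ Im s ≤ Kt + 1` is then zero-free for
  `λ = Z(β,t)/((1+δ) B^{2/3} L₁^{2/3} L₂^{1/3})`, and `(1 − β)/λ ≤ (1 + δ) L₁/log t`). Proof: a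
  descending chain `Z(ρ_{n+1}) < Z(ρ_n)/(1 + δ)`, `t_{n+1} ≤ 40t_n + 1` stays above `T₀` by the
  base window and must terminate, because Theorem 1.4 gives the a-priori bound
  `Z(β, t)(log t)^{1/3} ≥ 1.827` (`Literature.NumberTheory.LFunctions.VK.mtyZ_mul_rpow_ge`: `1 − β ≥ 0.305/log t`,
  `log log t ≥ 10.86`) while `log t_n ≤ log t₀ + n log 41` (Bernoulli's inequality finishes).

Everything here is proved (no new facts).

## References

* M. J. Mossinghoff, T. S. Trudgian, A. Yang, op. cit., §5: (5.1)–(5.4) and the "third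
  inequality"; Theorem 1.4 (`MossinghoffTrudgianYangRNT2024`).
-/

noncomputable section
open Complex Real

namespace Literature.NumberTheory.LFunctions.VK

/-- `r₁ r₂ ≤ u^{2/3} (log u)^{1/3}` from the certificates of `denom_ge`. [folklore] -/
theorem pow_mul_log_pow_ge {u a r₁ r₂ f : ℝ} {k : ℕ} (hau : a ≤ u) (ha : 0 < a) (hr₂ : 0 ≤ r₂)
    (h₁ : r₁ ^ 3 ≤ a ^ 2) (hf0 : 0 ≤ f) (hf1 : f ≤ 1) (h₂ : r₂ ^ 3 ≤ k + f)
    (hexp : expUB k f ≤ a) :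
    r₁ * r₂ ≤ u ^ (2 / 3 : ℝ) * Real.log u ^ (1 / 3 : ℝ) := by
  have := denom_ge hau ha hr₂ h₁ hf0 hf1 h₂ hexp
  nlinarith

/-- `4.45^{2/3} ≥ 2.70545` (`2.70545³ ≤ 4.45²`). [folklore] -/
theorem ford_B_two_thirds_ge : (2.70545 : ℝ) ≤ (4.45 : ℝ) ^ (2 / 3 : ℝ) := by
  refine le_of_pow_le_pow_left₀ (n := 3) (by norm_num) (by positivity) ?_
  rw [rpow_two_thirds_pow_three (by norm_num)]
  norm_num

/-- **The "third inequality" of §5 of Mossinghoff–Trudgian–Yang** ("verified by a numerical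
computation" there): on `52237.99 ≤ log t ≤ 52238` the intermediate region of Theorem 1.4 is
wider than `M₁ B^{-2/3} (log t)^{-2/3} (log log t)^{-1/3}` (`M₁ = 0.048976`, `B = 4.45`), i.e.
`(0.05035/h − 0.0349/h²) · 4.45^{2/3} u^{2/3} (log u)^{1/3} ≥ 0.048976`, `h = (27/164)u + 7.096`
(relative margin `1.0·10⁻⁵` at `u = 52238`). [cite: MossinghoffTrudgianYangRNT2024, §5 (third inequality)] -/
theorem third_inequality {u : ℝ} (h1 : 52237.99 ≤ u) (h2 : u ≤ 52238) :
    0.048976 ≤ (0.05035 / (27 / 164 * u + 7.096) - 0.0349 / (27 / 164 * u + 7.096) ^ 2)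
      * (4.45 : ℝ) ^ (2 / 3 : ℝ) * (u ^ (2 / 3 : ℝ) * Real.log u ^ (1 / 3 : ℝ)) := by
  have hD := pow_mul_log_pow_ge (u := u) (a := 52237.99) (r₁ := 1397.4114) (r₂ := 2.214746)
    (k := 10) (f := 0.863565) h1 (by norm_num) (by norm_num) (by norm_num) (by norm_num)
    (by norm_num) (by norm_num) (by norm_num [expUB])
  have hW := inter_anti (h₁ := 27 / 164 * u + 7.096) (h₂ := 27 / 164 * 52238 + 7.096)
    (by linarith) (by linarith)
  have hW0 : (0 : ℝ) < 0.05035 / (27 / 164 * 52238 + 7.096) - 0.0349 / (27 / 164 * 52238 + 7.096) ^ 2 := by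
    norm_num
  have hB := ford_B_two_thirds_ge
  have step1 : (0.048976 : ℝ) ≤ (0.05035 / (27 / 164 * 52238 + 7.096) - 0.0349 / (27 / 164 * 52238 + 7.096) ^ 2)
      * 2.70545 * (1397.4114 * 2.214746) := by norm_num
  calc (0.048976 : ℝ) ≤ _ := step1
    _ ≤ _ := by
      apply mul_le_mul (mul_le_mul hW hB (by norm_num) (hW0.le.trans hW)) hD (by norm_num)
      exact mul_nonneg (hW0.le.trans hW) (by positivity)

/-! ### The intermediate region from a given height on -/

/-- The intermediate zero-free region of Theorem 1.4 of the source, asserted for `|t| ≥ T`: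
`ζ(σ + it) ≠ 0` for `|t| ≥ T` and `σ > 1 − 0.05035/h + 0.0349/h²`, `h = (27/164) log|t| + 7.096`.
Theorem 1.4 (`zero_free_region_intermediate_mossinghoff_trudgian_yang`) is the case `T = exp 1000`
(`intermediateRegionFrom_of_intermediate`); the §5 argument below and the assembly of rh.S10 use
it only for `|t| ≥ exp 7000`, and are therefore stated with the hypothesis
`IntermediateRegionFrom (exp 7000)` (so that any proof of Theorem 1.4 from a larger height on —
e.g. from Lemma 6.1 of the source, whose window `[t − 1, 40t + 1]` forces a threshold slightly
above `exp 1000` — can be fed in). [cite: MossinghoffTrudgianYangRNT2024, Theorem 1.4] -/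
def IntermediateRegionFrom (T : ℝ) : Prop :=
  ∀ σ t : ℝ, T ≤ |t| →
    1 - 0.05035 / (27 / 164 * Real.log |t| + 7.096)
      + 0.0349 / (27 / 164 * Real.log |t| + 7.096) ^ 2 < σ →
    riemannZeta (σ + t * I) ≠ 0

/-- `IntermediateRegionFrom` is monotone in the threshold. [folklore] -/
theorem IntermediateRegionFrom.mono {T T' : ℝ} (h : IntermediateRegionFrom T) (hT : T ≤ T') :
    IntermediateRegionFrom T' :=
  fun σ t ht hσ ↦ h σ t (hT.trans ht) hσ

/-- Theorem 1.4 is `IntermediateRegionFrom (exp 1000)`. [cite: MossinghoffTrudgianYangRNT2024, Theorem 1.4] -/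
theorem intermediateRegionFrom_of_intermediate
    (h : zero_free_region_intermediate_mossinghoff_trudgian_yang) :
    IntermediateRegionFrom (Real.exp 1000) :=
  fun σ t ht hσ ↦ h σ t ht hσ

/-- Theorem 1.4 gives `IntermediateRegionFrom (exp 7000)`, the form used below.
[cite: MossinghoffTrudgianYangRNT2024, Theorem 1.4] -/
theorem intermediateRegionFrom_exp_7000
    (h : zero_free_region_intermediate_mossinghoff_trudgian_yang) :
    IntermediateRegionFrom (Real.exp 7000) :=
  (intermediateRegionFrom_of_intermediate h).mono (Real.exp_le_exp.2 (by norm_num))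

/-- Zeros of height `t ∈ [exp 52237.99, exp 52238]` obey the large-height bound `Z(β, t) ≥ M₁`
by Theorem 1.4 and the third inequality — the base window `[T₀ − 1, T₀)` of the §5 argument.
[cite: MossinghoffTrudgianYangRNT2024, §5] -/
theorem zero_bound_base_window' (hI : IntermediateRegionFrom (Real.exp 7000))
    {β t : ℝ} (ht1 : Real.exp 52237.99 ≤ t) (ht2 : t ≤ Real.exp 52238)
    (hz : riemannZeta (β + t * I) = 0) :
    0.048976 ≤ (1 - β) * (4.45 : ℝ) ^ (2 / 3 : ℝ) * Real.log t ^ (2 / 3 : ℝ)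
      * Real.log (Real.log t) ^ (1 / 3 : ℝ) := by
  have ht0 : 0 < t := (Real.exp_pos _).trans_le ht1
  have hu1 : 52237.99 ≤ Real.log t := by rw [Real.le_log_iff_exp_le ht0]; exact ht1
  have hu2 : Real.log t ≤ 52238 := by rw [Real.log_le_iff_le_exp ht0]; exact ht2
  have hβ : 0.05035 / (27 / 164 * Real.log t + 7.096) - 0.0349 / (27 / 164 * Real.log t + 7.096) ^ 2
      ≤ 1 - β := by
    by_contra hc
    push Not at hc
    refine hI β t ?_ ?_ hz
    · rw [abs_of_pos ht0]; exact (Real.exp_le_exp.2 (by norm_num)).trans ht1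
    · rw [abs_of_pos ht0]; linarith
  have h3 := third_inequality hu1 hu2
  have hl : 0 ≤ Real.log t := by linarith
  have hll : 0 ≤ Real.log (Real.log t) := Real.log_nonneg (by linarith)
  have hP : 0 ≤ (4.45 : ℝ) ^ (2 / 3 : ℝ) * (Real.log t ^ (2 / 3 : ℝ) * Real.log (Real.log t) ^ (1 / 3 : ℝ)) :=
    mul_nonneg (Real.rpow_nonneg (by norm_num) _)
      (mul_nonneg (Real.rpow_nonneg hl _) (Real.rpow_nonneg hll _))
  calc (0.048976 : ℝ) ≤ _ := h3
    _ = (0.05035 / (27 / 164 * Real.log t + 7.096) - 0.0349 / (27 / 164 * Real.log t + 7.096) ^ 2)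
        * ((4.45 : ℝ) ^ (2 / 3 : ℝ) * (Real.log t ^ (2 / 3 : ℝ) * Real.log (Real.log t) ^ (1 / 3 : ℝ))) := by ring
    _ ≤ (1 - β) * ((4.45 : ℝ) ^ (2 / 3 : ℝ) * (Real.log t ^ (2 / 3 : ℝ) * Real.log (Real.log t) ^ (1 / 3 : ℝ))) :=
        mul_le_mul_of_nonneg_right hβ hP
    _ = _ := by ring

/-- `exp 52237.99 ≤ exp 52238 − 1`: the window `[T₀ − 1, T₀]` lies inside `[exp 52237.99, exp 52238]`.
[folklore] -/
theorem exp_le_T0_sub_one : Real.exp 52237.99 ≤ Real.exp 52238 - 1 := by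
  have h1 : Real.exp 52238 = Real.exp 52237.99 * Real.exp 0.01 := by
    rw [← Real.exp_add]; norm_num
  have h2 : (0.01 : ℝ) + 1 ≤ Real.exp 0.01 := Real.add_one_le_exp _
  have h3 : (52237.99 : ℝ) + 1 ≤ Real.exp 52237.99 := Real.add_one_le_exp _
  nlinarith [Real.exp_pos (52237.99 : ℝ)]


/-! ### The function `Z(β, t)` and its a-priori lower bound from Theorem 1.4 -/

/-- `Z(β, t) = (1 − β) B^{2/3} (log t)^{2/3} (log log t)^{1/3}` with Ford's `B = 4.45`
(MTY (5.1)). (Meaningful for `t > e`; for `t ≤ e` the real powers of the non-positive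
`log log t` take Mathlib's junk values — all uses below have `t ≥ exp 52237.99`.)
[cite: MossinghoffTrudgianYangRNT2024, (5.1)] -/
def mtyZ (β t : ℝ) : ℝ :=
  (1 - β) * (4.45 : ℝ) ^ (2 / 3 : ℝ) * Real.log t ^ (2 / 3 : ℝ) * Real.log (Real.log t) ^ (1 / 3 : ℝ)

/-- `(log u)^{1/3} ≥ 2.2147` for `u ≥ 52238` (`exp 10.863565 ≤ 52238`, `2.2147³ ≤ 10.863565`).
[folklore] -/
theorem loglog_rpow_third_ge {u : ℝ} (hu : 52238 ≤ u) : 2.2147 ≤ Real.log u ^ (1 / 3 : ℝ) := by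
  have hu0 : 0 < u := by linarith
  have hlog : (10 : ℕ) + 0.863565 ≤ Real.log u := by
    rw [Real.le_log_iff_exp_le hu0]
    exact (exp_le_of_expUB_le (k := 10) (f := 0.863565) (X := 52238) (by norm_num) (by norm_num)
      (by norm_num [expUB])).trans hu
  have hlog0 : 0 ≤ Real.log u := le_trans (by norm_num) hlog
  refine le_of_pow_le_pow_left₀ (n := 3) (by norm_num) (by positivity) ?_
  rw [rpow_one_third_pow_three hlog0]
  norm_num at hlog ⊢
  linarith

/-- Theorem 1.4 gives, for zeros of height `t ≥ exp 52238`, `1 − β ≥ 0.305/log t`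
(`0.05035/h − 0.0349/h² ≥ 0.305/log t` for `h = (27/164) log t + 7.096`, `log t ≥ 52238`).
[cite: MossinghoffTrudgianYangRNT2024, Theorem 1.4] -/
theorem one_sub_ge_of_intermediate' (hI : IntermediateRegionFrom (Real.exp 7000))
    {β t : ℝ} (ht : Real.exp 52238 ≤ t) (hz : riemannZeta (β + t * I) = 0) :
    0.305 / Real.log t ≤ 1 - β := by
  have ht0 : 0 < t := (Real.exp_pos _).trans_le ht
  have hL : 52238 ≤ Real.log t := by rw [Real.le_log_iff_exp_le ht0]; exact ht
  have hβ : 0.05035 / (27 / 164 * Real.log t + 7.096) - 0.0349 / (27 / 164 * Real.log t + 7.096) ^ 2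
      ≤ 1 - β := by
    by_contra hc
    push Not at hc
    refine hI β t ?_ ?_ hz
    · rw [abs_of_pos ht0]; exact (Real.exp_le_exp.2 (by norm_num)).trans ht
    · rw [abs_of_pos ht0]; linarith
  refine le_trans ?_ hβ
  set L := Real.log t with hLdef
  have hh : 0 < 27 / 164 * L + 7.096 := by linarith
  rw [div_sub_div _ _ hh.ne' (pow_ne_zero 2 hh.ne'), div_le_div_iff₀ (by linarith) (by positivity)]
  nlinarith [mul_nonneg (sub_nonneg.2 hL) (sub_nonneg.2 hL), sub_nonneg.2 hL]

/-- **A-priori lower bound.** For a zero `β + it` with `t ≥ exp 52238`,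
`Z(β, t) · (log t)^{1/3} ≥ 1.827` (from Theorem 1.4: `Z ≥ 0.305 · 4.45^{2/3} (log log t)^{1/3}
/ (log t)^{1/3}` and `log log t ≥ 10.86`). This polynomial decay in `log t` is what makes the
descending chains of §5 finite. [cite: MossinghoffTrudgianYangRNT2024, Theorem 1.4 and §5] -/
theorem mtyZ_mul_rpow_ge' (hI : IntermediateRegionFrom (Real.exp 7000))
    {β t : ℝ} (ht : Real.exp 52238 ≤ t) (hz : riemannZeta (β + t * I) = 0) :
    1.827 ≤ mtyZ β t * Real.log t ^ (1 / 3 : ℝ) := by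
  have ht0 : 0 < t := (Real.exp_pos _).trans_le ht
  have hL : 52238 ≤ Real.log t := by rw [Real.le_log_iff_exp_le ht0]; exact ht
  have hL0 : 0 < Real.log t := by linarith
  have h1 := one_sub_ge_of_intermediate' hI ht hz
  have h2 := loglog_rpow_third_ge hL
  have hB := ford_B_two_thirds_ge
  have hsplit : Real.log t ^ (2 / 3 : ℝ) * Real.log t ^ (1 / 3 : ℝ) = Real.log t := by
    rw [← Real.rpow_add hL0]; norm_num
  have h1' : 0.305 ≤ (1 - β) * Real.log t := by
    rwa [div_le_iff₀ hL0] at h1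
  unfold mtyZ
  calc (1.827 : ℝ) ≤ 0.305 * 2.70545 * 2.2147 := by norm_num
    _ ≤ ((1 - β) * Real.log t) * (4.45 : ℝ) ^ (2 / 3 : ℝ) * Real.log (Real.log t) ^ (1 / 3 : ℝ) :=
        mul_le_mul (mul_le_mul h1' hB (by norm_num) (by nlinarith)) h2 (by norm_num) (by positivity)
    _ = _ := by
        rw [show (1 - β) * (4.45 : ℝ) ^ (2 / 3 : ℝ) * Real.log t ^ (2 / 3 : ℝ)
            * Real.log (Real.log t) ^ (1 / 3 : ℝ) * Real.log t ^ (1 / 3 : ℝ)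
            = ((1 - β) * (Real.log t ^ (2 / 3 : ℝ) * Real.log t ^ (1 / 3 : ℝ))) * (4.45 : ℝ) ^ (2 / 3 : ℝ)
              * Real.log (Real.log t) ^ (1 / 3 : ℝ) by ring, hsplit]

/-- `Z(β, t) ≥ 0` for a zero (`β < 1`) of height `t ≥ exp 52238`. [folklore] -/
theorem mtyZ_nonneg' (hI : IntermediateRegionFrom (Real.exp 7000))
    {β t : ℝ} (ht : Real.exp 52238 ≤ t) (hz : riemannZeta (β + t * I) = 0) : 0 ≤ mtyZ β t := by
  have ht0 : 0 < t := (Real.exp_pos _).trans_le ht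
  have hL : 52238 ≤ Real.log t := by rw [Real.le_log_iff_exp_le ht0]; exact ht
  have h1 := one_sub_ge_of_intermediate' hI ht hz
  have h0 : 0 ≤ 1 - β := le_trans (by positivity) h1
  have hl : 0 ≤ Real.log t := by linarith
  have hll : 0 ≤ Real.log (Real.log t) := Real.log_nonneg (by linarith)
  unfold mtyZ
  exact mul_nonneg (mul_nonneg (mul_nonneg h0 (Real.rpow_nonneg (by norm_num) _))
    (Real.rpow_nonneg hl _)) (Real.rpow_nonneg hll _)

/-! ### Window-minimal zeros (closing the `M = 0` gap of the printed argument) -/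

/-- **Existence of a window-minimal counterexample (general threshold `M ≤ M₁`).** If some zero
`β₀ + it₀` with `t₀ ≥ T₀ = exp 52238` has `Z(β₀, t₀) < M` for a threshold `M ≤ M₁ = 0.048976`
(the source's `M₁`; the slack is needed by the in-tree derivation of §5, see the caveat in
`VinogradovKorobov.lean`), then for every `δ > 0` there is such a zero `β + it` (`Z(β, t) < M`)
which is moreover *window-minimal up to the factor `1 + δ`*: every zero `β' + it'`
with `t − 1 ≤ t' ≤ 40t + 1` has `(1 + δ) Z(β', t') ≥ Z(β, t)`. (The source, §5, takes instead a
zero with `Z ≤ M(1 + δ)` for `M = inf Z`, which requires `M > 0`; here a descending chain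
`Z(ρ_{n+1}) < Z(ρ_n)/(1+δ)`, `t_{n+1} ≤ 40 t_n + 1`, must terminate because
`Z(ρ_n) ≥ 1.827 (log t_n)^{-1/3} ≥ 1.827 (log t₀ + n log 41)^{-1/3}` by Theorem 1.4 while
`Z(ρ_n) < M₁ (1+δ)^{-n}`; zeros of the window below `T₀` are excluded by the third inequality.)
[cite: MossinghoffTrudgianYangRNT2024, §5 (choice of the zero β + it, (5.3)–(5.4))] -/
theorem exists_window_minimal_zero_of_le' (hI : IntermediateRegionFrom (Real.exp 7000))
    {M : ℝ} (hM : M ≤ 0.048976) {δ : ℝ} (hδ : 0 < δ) {β₀ t₀ : ℝ} (ht₀ : Real.exp 52238 ≤ t₀)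
    (hz₀ : riemannZeta (β₀ + t₀ * I) = 0) (hZ₀ : mtyZ β₀ t₀ < M) :
    ∃ β t : ℝ, Real.exp 52238 ≤ t ∧ riemannZeta (β + t * I) = 0 ∧ mtyZ β t < M ∧
      ∀ β' t' : ℝ, t - 1 ≤ t' → t' ≤ 40 * t + 1 → riemannZeta (β' + t' * I) = 0 →
        mtyZ β t ≤ (1 + δ) * mtyZ β' t' := by
  by_contra hcon
  push Not at hcon
  -- the successor map on counterexamples
  have hstep : ∀ p : ℝ × ℝ, (Real.exp 52238 ≤ p.2 ∧ riemannZeta (p.1 + p.2 * I) = 0 ∧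
      mtyZ p.1 p.2 < M) → ∃ q : ℝ × ℝ, (Real.exp 52238 ≤ q.2 ∧
        riemannZeta (q.1 + q.2 * I) = 0 ∧ mtyZ q.1 q.2 < M) ∧
        (q.2 ≤ 40 * p.2 + 1 ∧ (1 + δ) * mtyZ q.1 q.2 < mtyZ p.1 p.2) := by
    rintro ⟨β, t⟩ ⟨ht, hz, hZ⟩
    obtain ⟨β', t', h1, h2, hz', hlt⟩ := hcon β t ht hz hZ
    have hZ'0 : 0 ≤ mtyZ β' t' ∨ t' < Real.exp 52238 := by
      rcases le_or_gt (Real.exp 52238) t' with h | h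
      · exact Or.inl (mtyZ_nonneg' hI h hz')
      · exact Or.inr h
    have ht' : Real.exp 52238 ≤ t' := by
      by_contra hc
      push Not at hc
      -- `t' ∈ [T₀ − 1, T₀)`: the base window gives `Z(β', t') ≥ M₁ > Z(β, t) > (1+δ) Z(β', t')`
      have hw1 : Real.exp 52237.99 ≤ t' := exp_le_T0_sub_one.trans (by linarith)
      have hbase := zero_bound_base_window' hI hw1 hc.le hz'
      have : mtyZ β' t' = (1 - β') * (4.45 : ℝ) ^ (2 / 3 : ℝ) * Real.log t' ^ (2 / 3 : ℝ)
          * Real.log (Real.log t') ^ (1 / 3 : ℝ) := rfl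
      rw [← this] at hbase
      nlinarith
    have hZ'nn : 0 ≤ mtyZ β' t' := mtyZ_nonneg' hI ht' hz'
    refine ⟨(β', t'), ⟨ht', hz', ?_⟩, h2, hlt⟩
    nlinarith
  choose! F hF using hstep
  set P : ℝ × ℝ → Prop := fun p ↦ Real.exp 52238 ≤ p.2 ∧ riemannZeta (p.1 + p.2 * I) = 0 ∧
    mtyZ p.1 p.2 < M with hPdef
  set s : ℕ → ℝ × ℝ := fun n ↦ F^[n] (β₀, t₀) with hsdef
  have hPs : ∀ n, P (s n) := by
    intro n
    induction n with
    | zero => exact ⟨ht₀, hz₀, hZ₀⟩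
    | succ n ih =>
      have := (hF (s n) ih).1
      simpa only [hsdef, Function.iterate_succ_apply'] using this
  have hRs : ∀ n, (s (n + 1)).2 ≤ 40 * (s n).2 + 1 ∧
      (1 + δ) * mtyZ (s (n + 1)).1 (s (n + 1)).2 < mtyZ (s n).1 (s n).2 := by
    intro n
    have := (hF (s n) (hPs n)).2
    simpa only [hsdef, Function.iterate_succ_apply'] using this
  -- geometric decay of `Z` along the chain
  have hZdec : ∀ n, mtyZ (s n).1 (s n).2 * (1 + δ) ^ n ≤ mtyZ β₀ t₀ := by
    intro n
    induction n with
    | zero => simp [hsdef]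
    | succ n ih =>
      have h := (hRs n).2
      have hpow : 0 ≤ (1 + δ) ^ n := by positivity
      calc mtyZ (s (n + 1)).1 (s (n + 1)).2 * (1 + δ) ^ (n + 1)
          = ((1 + δ) * mtyZ (s (n + 1)).1 (s (n + 1)).2) * (1 + δ) ^ n := by ring
        _ ≤ mtyZ (s n).1 (s n).2 * (1 + δ) ^ n := mul_le_mul_of_nonneg_right h.le hpow
        _ ≤ _ := ih
  -- at most geometric growth of the heights
  have ht₀pos : 0 < t₀ := (Real.exp_pos _).trans_le ht₀
  have hTgrow : ∀ n, (s n).2 ≤ 41 ^ n * t₀ := by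
    intro n
    induction n with
    | zero => simp [hsdef]
    | succ n ih =>
      have h := (hRs n).1
      have h1 : 1 ≤ (s n).2 := le_trans (by have := Real.add_one_le_exp (52238 : ℝ); linarith) (hPs n).1
      calc (s (n + 1)).2 ≤ 40 * (s n).2 + 1 := h
        _ ≤ 41 * (s n).2 := by linarith
        _ ≤ 41 * (41 ^ n * t₀) := by gcongr
        _ = _ := by ring
  have hlog : ∀ n, Real.log (s n).2 ≤ Real.log t₀ + n * Real.log 41 := by
    intro n
    have hpos : 0 < (s n).2 := (Real.exp_pos _).trans_le (hPs n).1
    calc Real.log (s n).2 ≤ Real.log (41 ^ n * t₀) := Real.log_le_log hpos (hTgrow n)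
      _ = _ := by rw [Real.log_mul (by positivity) ht₀pos.ne', Real.log_pow]; ring
  -- combine with the a-priori lower bound: `1.827 (1+δ)^n < M₁ (log t_n)^{1/3}`
  have hkey : ∀ n : ℕ, 1.827 * (1 + δ) ^ n
      < 0.048976 * (Real.log t₀ + (n : ℝ) * Real.log 41) ^ (1 / 3 : ℝ) := by
    intro n
    obtain ⟨htn, hzn, hZn⟩ := hPs n
    have hlow := mtyZ_mul_rpow_ge' hI htn hzn
    have hpos : 0 < (s n).2 := (Real.exp_pos _).trans_le htn
    have hLn : 52238 ≤ Real.log (s n).2 := by rw [Real.le_log_iff_exp_le hpos]; exact htn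
    have hr : Real.log (s n).2 ^ (1 / 3 : ℝ) ≤ (Real.log t₀ + n * Real.log 41) ^ (1 / 3 : ℝ) :=
      Real.rpow_le_rpow (by linarith) (hlog n) (by norm_num)
    have hr0 : 0 < Real.log (s n).2 ^ (1 / 3 : ℝ) := Real.rpow_pos_of_pos (by linarith) _
    have hdec := hZdec n
    have hpow : 0 < (1 + δ) ^ n := by positivity
    -- 1.827 (1+δ)^n ≤ Z_n (log t_n)^{1/3} (1+δ)^n ≤ Z₀ (log t_n)^{1/3} < M₁ (log t_n)^{1/3}
    calc 1.827 * (1 + δ) ^ n ≤ mtyZ (s n).1 (s n).2 * Real.log (s n).2 ^ (1 / 3 : ℝ) * (1 + δ) ^ n :=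
          mul_le_mul_of_nonneg_right hlow hpow.le
      _ = (mtyZ (s n).1 (s n).2 * (1 + δ) ^ n) * Real.log (s n).2 ^ (1 / 3 : ℝ) := by ring
      _ ≤ mtyZ β₀ t₀ * Real.log (s n).2 ^ (1 / 3 : ℝ) := mul_le_mul_of_nonneg_right hdec hr0.le
      _ < 0.048976 * Real.log (s n).2 ^ (1 / 3 : ℝ) := mul_lt_mul_of_pos_right (hZ₀.trans_le hM) hr0
      _ ≤ _ := mul_le_mul_of_nonneg_left hr (by norm_num)
  -- cube and use Bernoulli: `(n δ)³ · 1.827³ ≤ (1+δ)^{3n} 1.827³ < M₁³ (log t₀ + n log 41)`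
  have hL₀ : 0 < Real.log t₀ := by
    have : 52238 ≤ Real.log t₀ := by rw [Real.le_log_iff_exp_le ht₀pos]; exact ht₀
    linarith
  have h41 : 0 < Real.log 41 := Real.log_pos (by norm_num)
  have hcube : ∀ n : ℕ, (n * δ) ^ 3 * 1.827 ^ 3 < 0.048976 ^ 3 * (Real.log t₀ + n * Real.log 41) := by
    intro n
    have hk := hkey n
    have hA0 : 0 ≤ Real.log t₀ + n * Real.log 41 := by positivity
    have hk3 := pow_lt_pow_left₀ hk (by positivity) (three_ne_zero)
    rw [mul_pow, mul_pow, ← Real.rpow_natCast ((Real.log t₀ + n * Real.log 41) ^ (1 / 3 : ℝ)) 3,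
      ← Real.rpow_mul hA0] at hk3
    norm_num at hk3
    have hbern : 1 + n * δ ≤ (1 + δ) ^ n := one_add_mul_le_pow (by linarith) n
    have hb3 : (n * δ) ^ 3 ≤ ((1 + δ) ^ n) ^ 3 :=
      pow_le_pow_left₀ (by positivity) (by linarith) 3
    nlinarith
  -- contradiction for large `n`
  set C := 0.048976 ^ 3 * (Real.log t₀ + Real.log 41) / (δ ^ 3 * 1.827 ^ 3) with hC
  have hC0 : 0 ≤ C := by positivity
  obtain ⟨n, hn⟩ := exists_nat_gt (C + 1)
  have hn1 : (1 : ℝ) ≤ n := by linarith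
  have hnpos : (0 : ℝ) < n := by linarith
  have h := hcube n
  have hlin : Real.log t₀ + n * Real.log 41 ≤ n * (Real.log t₀ + Real.log 41) := by nlinarith
  have hδ3 : 0 < δ ^ 3 * 1.827 ^ 3 := by positivity
  have h2 : (n : ℝ) * ((n : ℝ) ^ 2 * (δ ^ 3 * 1.827 ^ 3))
      < (n : ℝ) * (0.048976 ^ 3 * (Real.log t₀ + Real.log 41)) := by
    have e1 : (n : ℝ) * ((n : ℝ) ^ 2 * (δ ^ 3 * 1.827 ^ 3)) = (n * δ) ^ 3 * 1.827 ^ 3 := by ring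
    have e2 : (n : ℝ) * (0.048976 ^ 3 * (Real.log t₀ + Real.log 41))
        = 0.048976 ^ 3 * (n * (Real.log t₀ + Real.log 41)) := by ring
    rw [e1, e2]
    exact h.trans_le (by gcongr)
  have h3 := lt_of_mul_lt_mul_left h2 hnpos.le
  have h4 : (n : ℝ) ^ 2 < C := by rw [hC, lt_div_iff₀ hδ3]; exact h3
  nlinarith

/-- **Existence of a window-minimal counterexample** at the source's threshold `M₁ = 0.048976`
(the case `M = M₁` of `exists_window_minimal_zero_of_le'`); form with `IntermediateRegionFrom (exp 7000)`.
[cite: MossinghoffTrudgianYangRNT2024, §5 (choice of the zero β + it, (5.3)–(5.4))] -/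
theorem exists_window_minimal_zero' (hI : IntermediateRegionFrom (Real.exp 7000))
    {δ : ℝ} (hδ : 0 < δ) {β₀ t₀ : ℝ} (ht₀ : Real.exp 52238 ≤ t₀)
    (hz₀ : riemannZeta (β₀ + t₀ * I) = 0) (hZ₀ : mtyZ β₀ t₀ < 0.048976) :
    ∃ β t : ℝ, Real.exp 52238 ≤ t ∧ riemannZeta (β + t * I) = 0 ∧ mtyZ β t < 0.048976 ∧
      ∀ β' t' : ℝ, t - 1 ≤ t' → t' ≤ 40 * t + 1 → riemannZeta (β' + t' * I) = 0 →
        mtyZ β t ≤ (1 + δ) * mtyZ β' t' :=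
  exists_window_minimal_zero_of_le' hI le_rfl hδ ht₀ hz₀ hZ₀

/-! ### The same statements from Theorem 1.4 itself

The unprimed forms below take the named fact `zero_free_region_intermediate_mossinghoff_trudgian_yang`
(Theorem 1.4, from `exp 1000`) and are the primed ones composed with
`intermediateRegionFrom_exp_7000`; they are the interface used by
`VinogradovKorobovLargeHeightLemmas.lean` and `VinogradovKorobovLargeHeightMain.lean`. -/

/-- Zeros of height `t ∈ [exp 52237.99, exp 52238]` obey `Z(β, t) ≥ M₁`, from Theorem 1.4
(`zero_bound_base_window'`). [cite: MossinghoffTrudgianYangRNT2024, §5] -/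
theorem zero_bound_base_window (hI : zero_free_region_intermediate_mossinghoff_trudgian_yang)
    {β t : ℝ} (ht1 : Real.exp 52237.99 ≤ t) (ht2 : t ≤ Real.exp 52238)
    (hz : riemannZeta (β + t * I) = 0) :
    0.048976 ≤ (1 - β) * (4.45 : ℝ) ^ (2 / 3 : ℝ) * Real.log t ^ (2 / 3 : ℝ)
      * Real.log (Real.log t) ^ (1 / 3 : ℝ) :=
  zero_bound_base_window' (intermediateRegionFrom_exp_7000 hI) ht1 ht2 hz

/-- A zero with `t ≥ exp 52238` has `1 − β ≥ 0.305/log t`, from Theorem 1.4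
(`one_sub_ge_of_intermediate'`). [cite: MossinghoffTrudgianYangRNT2024, Theorem 1.4] -/
theorem one_sub_ge_of_intermediate (hI : zero_free_region_intermediate_mossinghoff_trudgian_yang)
    {β t : ℝ} (ht : Real.exp 52238 ≤ t) (hz : riemannZeta (β + t * I) = 0) :
    0.305 / Real.log t ≤ 1 - β :=
  one_sub_ge_of_intermediate' (intermediateRegionFrom_exp_7000 hI) ht hz

/-- A zero with `t ≥ exp 52238` has `Z(β, t)(log t)^{1/3} ≥ 1.827`, from Theorem 1.4
(`mtyZ_mul_rpow_ge'`). [cite: MossinghoffTrudgianYangRNT2024, Theorem 1.4 and §5] -/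
theorem mtyZ_mul_rpow_ge (hI : zero_free_region_intermediate_mossinghoff_trudgian_yang)
    {β t : ℝ} (ht : Real.exp 52238 ≤ t) (hz : riemannZeta (β + t * I) = 0) :
    1.827 ≤ mtyZ β t * Real.log t ^ (1 / 3 : ℝ) :=
  mtyZ_mul_rpow_ge' (intermediateRegionFrom_exp_7000 hI) ht hz

/-- A zero with `t ≥ exp 52238` has `Z(β, t) ≥ 0`, from Theorem 1.4 (`mtyZ_nonneg'`). [folklore] -/
theorem mtyZ_nonneg (hI : zero_free_region_intermediate_mossinghoff_trudgian_yang)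
    {β t : ℝ} (ht : Real.exp 52238 ≤ t) (hz : riemannZeta (β + t * I) = 0) : 0 ≤ mtyZ β t :=
  mtyZ_nonneg' (intermediateRegionFrom_exp_7000 hI) ht hz

/-- Existence of a window-minimal zero below any threshold `M ≤ M₁`, from Theorem 1.4
(`exists_window_minimal_zero_of_le'`). [cite: MossinghoffTrudgianYangRNT2024, §5 (choice of the zero β + it, (5.3)–(5.4))] -/
theorem exists_window_minimal_zero_of_le (hI : zero_free_region_intermediate_mossinghoff_trudgian_yang)
    {M : ℝ} (hM : M ≤ 0.048976) {δ : ℝ} (hδ : 0 < δ) {β₀ t₀ : ℝ} (ht₀ : Real.exp 52238 ≤ t₀)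
    (hz₀ : riemannZeta (β₀ + t₀ * I) = 0) (hZ₀ : mtyZ β₀ t₀ < M) :
    ∃ β t : ℝ, Real.exp 52238 ≤ t ∧ riemannZeta (β + t * I) = 0 ∧ mtyZ β t < M ∧
      ∀ β' t' : ℝ, t - 1 ≤ t' → t' ≤ 40 * t + 1 → riemannZeta (β' + t' * I) = 0 →
        mtyZ β t ≤ (1 + δ) * mtyZ β' t' :=
  exists_window_minimal_zero_of_le' (intermediateRegionFrom_exp_7000 hI) hM hδ ht₀ hz₀ hZ₀

/-- Existence of a window-minimal zero with `Z < M₁`, from Theorem 1.4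
(`exists_window_minimal_zero'`). [cite: MossinghoffTrudgianYangRNT2024, §5 (choice of the zero β + it, (5.3)–(5.4))] -/
theorem exists_window_minimal_zero (hI : zero_free_region_intermediate_mossinghoff_trudgian_yang)
    {δ : ℝ} (hδ : 0 < δ) {β₀ t₀ : ℝ} (ht₀ : Real.exp 52238 ≤ t₀)
    (hz₀ : riemannZeta (β₀ + t₀ * I) = 0) (hZ₀ : mtyZ β₀ t₀ < 0.048976) :
    ∃ β t : ℝ, Real.exp 52238 ≤ t ∧ riemannZeta (β + t * I) = 0 ∧ mtyZ β t < 0.048976 ∧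
      ∀ β' t' : ℝ, t - 1 ≤ t' → t' ≤ 40 * t + 1 → riemannZeta (β' + t' * I) = 0 →
        mtyZ β t ≤ (1 + δ) * mtyZ β' t' :=
  exists_window_minimal_zero_of_le hI le_rfl hδ ht₀ hz₀ hZ₀

end Literature.NumberTheory.LFunctions.VK
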